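import Literature.Computability.Complexity.ExtMonotoneCliqueGate
import Mathlib.Logic.Relation
import Mathlib.Data.Finset.Card
import Mathlib.Data.Fintype.Powerset

/-!
# `CliqueExtLowerBound` (stmt-PneNP-10682) — negative-side lemmas: very large cliques I (the 2-SAT cut identity)

Standing-adversary (cdisprove, gen 2) output for the crux
`Summit.PneNP.PneNP.Theses.ConvexRankGates.CliqueExtLowerBound` (stmt-PneNP-10682): the natural
strengthening of the crux to ALL clique schedules `k(m)` with `C(m, k(m))` superpolynomial is FALSE in the
regime `m - k = Θ(log m)` — `CLIQUE(m, m - c·⌊log₃ m⌋)` has polynomial-size circuits over the extended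
monotone basis, indeed over unbounded-fan-in {∧, ∨} alone (colour-coding + 2-SAT cuts):
  `CLIQUE(m, m-k)(G) = ⋁_{h ∈ 𝓗} ⋀_u (Cut_h[p_u,¬p_u](G) ∨ Cut_h[¬p_u,p_u](G))`
for every (m,k,k)-perfect hash family `𝓗`, where `Cut_h[a,b]` is NON-reachability in the implication
digraph of the 2-CNF "at most one chosen vertex per colour class of `h`, every NON-edge of `G` has a chosen
endpoint" (chosen set = complement of the clique); `Cut` is monotone in `G` and is computed by a reachability
dynamic programme of `O(m⁴)` ∧/∨-gates, and perfect hash families of size `k e^k log m ≤ m^{c+2}` exist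
(Mehlhorn–Schmidt counting). On the circuit side this improves the range of Andreev–Jukna 2008 ("Very large
cliques are easy to detect"; Jukna 2012, Thm 9.7: polynomial monotone FORMULAS for `m - k = O(√log m)`,
quoted as the state of the art in Chen–Hirahara–Oliveira–Pich–Rajgopal–Santhanam 2022, HM Frontier E4) to
`m - k = O(log m)`; the lower-bound side (Jukna 2012, Prop. 9.6, from Alon–Boppana by padding) gives
monotone hardness only for `m - k = ω(log³ m)`. Files: `LargeCliquesTwoSat` (the identity),
`LargeCliquesCircuit` (the cut programme as a circuit), `LargeCliquesHashing` (hash families, assembly,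
`not_lowerBoundAt_sub_clog`). Refuter seat cdisprove-stmt-PneNP-10682-g2, 2026-08-16.

This file: §1 the existence half of Aspvall–Plass–Tarjan for skew-symmetric implication relations
(`exists_assignment`: a reachability-closed consistent set of literals of maximal size is complete); §2 the
identity `cliqueFn_sub_eq_true_iff_exists_coloring_cut` (clique ↔ cover of the non-edges ↔ the 2-CNF of an
injective colouring is satisfiable ↔ no variable reaches its negation both ways; soundness needs NO
perfectness). References: B. Aspvall, M. Plass, R. Tarjan, IPL 8 (1979); N. Alon, R. Yuster, U. Zwick,
*Color-coding*, J. ACM 42 (1995); A. Andreev, S. Jukna, Discrete Math. 308 (2008); S. Jukna, *Boolean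
Function Complexity* (2012) §9.2.
-/

namespace Summit.PneNP.PneNP.Theorems.CliqueExtLowerBound.Negative

open Literature.Computability.Complexity Literature.Computability.Complexity.CliqueLPGate Finset

/-! ### 1. Skew-symmetric implication relations: no contradictory variable ⇒ a satisfying assignment -/

section TwoSat

variable {V : Type*}

/-- Negation of a literal `(v, s)`. [folklore] -/
def lneg (a : V × Bool) : V × Bool := (a.1, !a.2)

/-- Double negation. [folklore] -/
@[simp] theorem lneg_lneg (a : V × Bool) : lneg (lneg a) = a := by
  simp [lneg]

/-- Negation keeps the variable. [folklore] -/
@[simp] theorem lneg_fst (a : V × Bool) : (lneg a).1 = a.1 := rfl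

/-- Negation flips the sign. [folklore] -/
@[simp] theorem lneg_snd (a : V × Bool) : (lneg a).2 = !a.2 := rfl

/-- The assignment `σ` satisfies the literal `a`. [folklore] -/
def Holds (σ : V → Bool) (a : V × Bool) : Prop := σ a.1 = a.2

/-- Skew symmetry of an implication relation `R` on literals: `a → b` gives `¬b → ¬a`. [folklore] -/
def SkewSymm (R : V × Bool → V × Bool → Prop) : Prop := ∀ a b, R a b → R (lneg b) (lneg a)

variable {R : V × Bool → V × Bool → Prop}

/-- Reachability inherits skew symmetry (path reversal). [folklore] -/
theorem reach_lneg (hR : SkewSymm R) {a b : V × Bool} (h : Relation.ReflTransGen R a b) :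
    Relation.ReflTransGen R (lneg b) (lneg a) := by
  induction h with
  | refl => exact Relation.ReflTransGen.refl
  | tail _ hbc ih => exact Relation.ReflTransGen.head (hR _ _ hbc) ih

/-- An assignment respecting every arc respects every path. [folklore] -/
theorem holds_of_reach {σ : V → Bool} (hσ : ∀ a b, R a b → Holds σ a → Holds σ b) {a b : V × Bool}
    (h : Relation.ReflTransGen R a b) (ha : Holds σ a) : Holds σ b := by
  induction h with
  | refl => exact ha
  | tail _ hbc ih => exact hσ _ _ hbc ih

variable [Fintype V] [DecidableEq V]

/-- **Aspvall–Plass–Tarjan, existence half, for skew-symmetric implication relations**: if no variable `v`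
has both `(v,⊤) ⇝ (v,⊥)` and `(v,⊥) ⇝ (v,⊤)`, some assignment respects every arc. Proof: a reachability-
closed, consistent set of literals of maximal size is complete. [folklore] -/
theorem exists_assignment (hR : SkewSymm R)
    (hcons : ∀ v : V, ¬ (Relation.ReflTransGen R (v, true) (v, false) ∧
      Relation.ReflTransGen R (v, false) (v, true))) :
    ∃ σ : V → Bool, ∀ a b, R a b → Holds σ a → Holds σ b := by
  classical
  -- closed consistent sets of literals
  let P : Finset (V × Bool) → Prop := fun A =>
    (∀ a ∈ A, ∀ b, Relation.ReflTransGen R a b → b ∈ A) ∧ ∀ a ∈ A, lneg a ∉ A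
  obtain ⟨A, hAP, hmax⟩ : ∃ A : Finset (V × Bool), P A ∧ ∀ A' : Finset (V × Bool), P A' → A'.card ≤ A.card := by
    obtain ⟨A, hA, hmax⟩ := Finset.exists_max_image ((Finset.univ : Finset (Finset (V × Bool))).filter P)
      Finset.card ⟨∅, by simp [P]⟩
    exact ⟨A, (Finset.mem_filter.1 hA).2, fun A' hA' => hmax A' (Finset.mem_filter.2 ⟨Finset.mem_univ _, hA'⟩)⟩
  have hclosed := hAP.1
  have hconsA := hAP.2
  -- completeness: every variable is decided in `A`
  have complete : ∀ v : V, (v, true) ∈ A ∨ (v, false) ∈ A := by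
    intro v
    by_contra hv
    push Not at hv
    -- adding the closure of a literal `p` over `v` to `A` keeps `P` unless `p ⇝ ¬p`
    have key : ∀ p : V × Bool, p.1 = v → Relation.ReflTransGen R p (lneg p) := by
      intro p hp
      have hpA : p ∉ A := by
        rcases p with ⟨w, _ | _⟩ <;> simp only at hp <;> subst hp
        · exact hv.2
        · exact hv.1
      have hnpA : lneg p ∉ A := by
        rcases p with ⟨w, _ | _⟩ <;> simp only at hp <;> subst hp
        · exact hv.1
        · exact hv.2
      by_contra hnreach
      let C : Finset (V × Bool) := A ∪ Finset.univ.filter fun b => Relation.ReflTransGen R p b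
      have hCP : P C := by
        constructor
        · intro a ha b hab
          rcases Finset.mem_union.1 ha with ha | ha
          · exact Finset.mem_union.2 (Or.inl (hclosed a ha b hab))
          · exact Finset.mem_union.2 (Or.inr (Finset.mem_filter.2
              ⟨Finset.mem_univ _, ((Finset.mem_filter.1 ha).2).trans hab⟩))
        · intro a ha hna
          rcases Finset.mem_union.1 ha with ha | ha <;> rcases Finset.mem_union.1 hna with hna | hna
          · exact hconsA a ha hna
          · have h1 : Relation.ReflTransGen R p (lneg a) := (Finset.mem_filter.1 hna).2
            have h2 : Relation.ReflTransGen R a (lneg p) := by simpa using reach_lneg hR h1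
            exact hnpA (hclosed a ha _ h2)
          · have h1 : Relation.ReflTransGen R p a := (Finset.mem_filter.1 ha).2
            have h2 : Relation.ReflTransGen R (lneg a) (lneg p) := reach_lneg hR h1
            exact hnpA (hclosed _ hna _ h2)
          · have h1 : Relation.ReflTransGen R p a := (Finset.mem_filter.1 ha).2
            have h2 : Relation.ReflTransGen R p (lneg a) := (Finset.mem_filter.1 hna).2
            have h3 : Relation.ReflTransGen R a (lneg p) := by simpa using reach_lneg hR h2
            exact hnreach (h1.trans h3)
      have hlt : A.card < C.card := by
        refine Finset.card_lt_card ⟨Finset.subset_union_left, fun hsub => hpA (hsub ?_)⟩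
        exact Finset.mem_union.2 (Or.inr (Finset.mem_filter.2 ⟨Finset.mem_univ _, Relation.ReflTransGen.refl⟩))
      exact absurd (hmax C hCP) (not_le.2 hlt)
    exact hcons v ⟨key (v, true) rfl, by simpa [lneg] using key (v, false) rfl⟩
  -- the assignment reads off `A`
  refine ⟨fun v => decide ((v, true) ∈ A), fun a b hab ha => ?_⟩
  have mem_iff : ∀ c : V × Bool, Holds (fun v => decide ((v, true) ∈ A)) c ↔ c ∈ A := by
    rintro ⟨w, _ | _⟩
    · simp only [Holds, decide_eq_false_iff_not]
      constructor
      · intro h; rcases complete w with h' | h'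
        · exact absurd h' h
        · exact h'
      · intro h h'; exact hconsA _ h' (by simpa [lneg] using h)
    · simp [Holds]
  rw [mem_iff] at ha ⊢
  exact hclosed a ha b (Relation.ReflTransGen.single hab)

end TwoSat

/-! ### 2. The implication digraph of a colouring, and the identity for CLIQUE(m, m-k) -/

section LargeClique

variable {m k : ℕ}

/-- `s(u,v)` is an edge of `K_m` for `u ≠ v`. [folklore] -/
theorem mk_mem_edgeSet_top {u v : Fin m} (h : u ≠ v) : s(u, v) ∈ (⊤ : SimpleGraph (Fin m)).edgeSet := by
  rw [SimpleGraph.mem_edgeSet]; exact h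

/-- The edge variable of the pair `{u, v}`, `u ≠ v`. [folklore] -/
def edgeOf {u v : Fin m} (h : u ≠ v) : (⊤ : SimpleGraph (Fin m)).edgeSet := ⟨s(u, v), mk_mem_edgeSet_top h⟩

/-- `edgeOf` is symmetric. [folklore] -/
theorem edgeOf_symm {u v : Fin m} (h : u ≠ v) : edgeOf h = edgeOf h.symm :=
  Subtype.ext (Sym2.eq_swap)

/-- Arcs of the implication digraph of the colouring `h` at the input graph `x`: FIXED arcs
`p_u → ¬p_v` for distinct `u, v` of the same colour ("at most one chosen vertex per class"), and VARIABLE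
arcs `¬p_u → p_v` for every NON-edge `uv` of `x` ("every non-edge has a chosen endpoint"). Literal `(u, b)`
is `p_u` for `b = true`, `¬p_u` for `b = false`. [folklore] -/
def Arc (h : Fin m → Fin k) (x : (⊤ : SimpleGraph (Fin m)).edgeSet → Bool) (a b : Fin m × Bool) : Prop :=
  (a.2 = true ∧ b.2 = false ∧ a.1 ≠ b.1 ∧ h a.1 = h b.1) ∨
  (a.2 = false ∧ b.2 = true ∧ ∃ hne : a.1 ≠ b.1, x (edgeOf hne) = false)

/-- `Cut h x a b`: `b` is not reachable from `a` — every `a → b` walk of the full digraph uses a variable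
arc of an EDGE of `x` (monotone in `x`). [folklore] -/
def Cut (h : Fin m → Fin k) (x : (⊤ : SimpleGraph (Fin m)).edgeSet → Bool) (a b : Fin m × Bool) : Prop :=
  ¬ Relation.ReflTransGen (Arc h x) a b

/-- The implication digraph is skew-symmetric. [folklore] -/
theorem arc_skewSymm (h : Fin m → Fin k) (x : (⊤ : SimpleGraph (Fin m)).edgeSet → Bool) :
    SkewSymm (Arc h x) := by
  rintro ⟨u, bu⟩ ⟨v, bv⟩ (⟨h1, h2, hne, hh⟩ | ⟨h1, h2, hne, hx⟩)
  · simp only at h1 h2 hne hh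
    subst h1; subst h2
    exact Or.inl ⟨rfl, rfl, fun h => hne h.symm, hh.symm⟩
  · simp only at h1 h2 hne hx
    subst h1; subst h2
    refine Or.inr ⟨rfl, rfl, fun h => hne h.symm, ?_⟩
    have key : edgeOf (fun h' => hne h'.symm : v ≠ u) = edgeOf hne := Subtype.ext Sym2.eq_swap
    exact (congrArg x key).trans hx

/-- `CLIQUE(m, m-k)` as a cover condition: some set of `≤ k` vertices meets every non-edge. [folklore] -/
theorem cliqueFn_sub_eq_true_iff_cover (hkm : k ≤ m) (x : (⊤ : SimpleGraph (Fin m)).edgeSet → Bool) :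
    cliqueFn m (m - k) x = true ↔
      ∃ S : Finset (Fin m), S.card ≤ k ∧ ∀ u v : Fin m, ∀ hne : u ≠ v, x (edgeOf hne) = false → u ∈ S ∨ v ∈ S := by
  classical
  rw [CliqueLPGate.cliqueFn_eq_true_iff_exists]
  constructor
  · rintro ⟨T, hT, hcl⟩
    refine ⟨Tᶜ, by rw [Finset.card_compl, Fintype.card_fin, hT]; omega, fun u v hne hx => ?_⟩
    by_contra hno
    push Not at hno
    rw [Finset.mem_compl, not_not, Finset.mem_compl, not_not] at hno
    have := hcl (edgeOf hne) (fun y hy => by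
      rcases Sym2.mem_iff.1 hy with rfl | rfl
      · exact hno.1
      · exact hno.2)
    rw [hx] at this
    exact Bool.false_ne_true this
  · rintro ⟨S, hS, hcov⟩
    obtain ⟨S', hSS', -, hS'⟩ := Finset.exists_subsuperset_card_eq (Finset.subset_univ S) hS
      (by rw [Finset.card_univ, Fintype.card_fin]; exact hkm)
    refine ⟨S'ᶜ, by rw [Finset.card_compl, Fintype.card_fin, hS'], fun e hin => ?_⟩
    obtain ⟨u, v, hne, he⟩ : ∃ u v : Fin m, ∃ hne : u ≠ v, e = edgeOf hne := by
      obtain ⟨e, he⟩ := e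
      induction e using Sym2.ind with
      | h u v =>
        exact ⟨u, v, (SimpleGraph.mem_edgeSet ⊤).1 he, rfl⟩
    subst he
    have hu : u ∈ S'ᶜ := hin u (Sym2.mem_mk_left u v)
    have hv : v ∈ S'ᶜ := hin v (Sym2.mem_mk_right u v)
    rw [Finset.mem_compl] at hu hv
    cases hx : x (edgeOf hne)
    · rcases hcov u v hne hx with h | h
      · exact absurd (hSS' h) hu
      · exact absurd (hSS' h) hv
    · rfl

/-- **Very large cliques through colour-coding and 2-SAT cuts.** For `k ≤ m` and EVERY family `𝓗` of
colourings `Fin m → Fin k` that is injective on every `k`-set of vertices: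
`CLIQUE(m, m-k)(x) = 1 ↔ ∃ h ∈ 𝓗, ∀ u, Cut_h[p_u, ¬p_u](x) ∨ Cut_h[¬p_u, p_u](x)`.
(⇒) the complement of an `(m-k)`-clique is a `k`-set `S` covering every non-edge; a colouring injective on
`S` makes "chosen = `S`" respect every arc, so no variable reaches its own negation in a direction it holds.
(⇐, for ANY colouring) no contradictory variable ⇒ a respecting assignment (`exists_assignment`); its chosen
set has ≤ 1 vertex per colour (fixed arcs), hence `≤ k` vertices, and meets every non-edge (variable arcs).
The right-hand side is a monotone {∧,∨}-circuit of size `|𝓗|·O(m³ log m)` (cut dynamic programme), so with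
a perfect hash family of size `k e^k log m` (Mehlhorn–Schmidt) CLIQUE(m, m-k) has polynomial monotone
circuits for every `k = O(log m)` — cf. Andreev–Jukna 2008 (Jukna 2012, Thm 9.7): `k = O(√log m)`.
[folklore] -/
theorem cliqueFn_sub_eq_true_iff_exists_coloring_cut (hkm : k ≤ m) {𝓗 : Set (Fin m → Fin k)}
    (hperf : ∀ S : Finset (Fin m), S.card = k → ∃ h ∈ 𝓗, Set.InjOn h ↑S)
    (x : (⊤ : SimpleGraph (Fin m)).edgeSet → Bool) :
    cliqueFn m (m - k) x = true ↔
      ∃ h ∈ 𝓗, ∀ u : Fin m, Cut h x (u, true) (u, false) ∨ Cut h x (u, false) (u, true) := by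
  classical
  rw [cliqueFn_sub_eq_true_iff_cover hkm]
  constructor
  · -- completeness
    rintro ⟨S, hS, hcov⟩
    obtain ⟨S', hSS', -, hS'⟩ := Finset.exists_subsuperset_card_eq (Finset.subset_univ S) hS
      (by rw [Finset.card_univ, Fintype.card_fin]; exact hkm)
    obtain ⟨h, hh, hinj⟩ := hperf S' hS'
    refine ⟨h, hh, fun u => ?_⟩
    -- the assignment "chosen = S'" respects every arc
    let σ : Fin m → Bool := fun w => decide (w ∈ S')
    have hσ : ∀ a b, Arc h x a b → Holds σ a → Holds σ b := by
      rintro ⟨a, ba⟩ ⟨b, bb⟩ (⟨h1, h2, hne, hh'⟩ | ⟨h1, h2, hne, hx⟩) ha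
      · simp only at h1 h2 hne hh'
        subst h1; subst h2
        simp only [Holds, σ, decide_eq_true_eq, decide_eq_false_iff_not] at ha ⊢
        exact fun hb => hne (hinj ha hb hh')
      · simp only at h1 h2 hne hx
        subst h1; subst h2
        simp only [Holds, σ, decide_eq_true_eq, decide_eq_false_iff_not] at ha ⊢
        rcases hcov a b hne hx with h' | h'
        · exact absurd (hSS' h') ha
        · exact hSS' h'
    by_cases hu : σ u = true
    · refine Or.inl fun hreach => ?_
      have : Holds σ (u, false) := holds_of_reach hσ hreach hu
      simp [Holds, hu] at this
    · refine Or.inr fun hreach => ?_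
      have hu' : Holds σ (u, false) := by simpa [Holds] using hu
      have : Holds σ (u, true) := holds_of_reach hσ hreach hu'
      exact hu this
  · -- soundness (for ANY colouring)
    rintro ⟨h, -, hcut⟩
    obtain ⟨σ, hσ⟩ := exists_assignment (arc_skewSymm h x) fun v hv => by
      rcases hcut v with hc | hc
      · exact hc hv.1
      · exact hc hv.2
    refine ⟨Finset.univ.filter fun w => σ w = true, ?_, fun u v hne hx => ?_⟩
    · -- at most one chosen vertex per colour class: `h` is injective on the chosen set
      have hinj : Set.InjOn h ↑(Finset.univ.filter fun w => σ w = true) := by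
        intro u hu v hv huv
        simp only [Finset.coe_filter, Finset.mem_univ, true_and, Set.mem_setOf_eq] at hu hv
        by_contra hne
        have harc : Arc h x (u, true) (v, false) := Or.inl ⟨rfl, rfl, hne, huv⟩
        have := hσ _ _ harc hu
        simp [Holds, hv] at this
      calc (Finset.univ.filter fun w => σ w = true).card
          = ((Finset.univ.filter fun w => σ w = true).image h).card :=
            (Finset.card_image_of_injOn hinj).symm
        _ ≤ (Finset.univ : Finset (Fin k)).card := Finset.card_le_card (Finset.subset_univ _)
        _ = k := by rw [Finset.card_univ, Fintype.card_fin]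
    · -- every non-edge has a chosen endpoint
      simp only [Finset.mem_filter, Finset.mem_univ, true_and]
      cases hu : σ u
      · have harc : Arc h x (u, false) (v, true) := Or.inr ⟨rfl, rfl, hne, hx⟩
        exact Or.inr (hσ _ _ harc hu)
      · exact Or.inl rfl

end LargeClique


end Summit.PneNP.PneNP.Theorems.CliqueExtLowerBound.Negative
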